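import Literature.NumberTheory.Automorphic.ArchStableOrbitalRegularState   -- ★ (R1-0): brings ★ (h0) `isHaarMeasure_map_archPiEquivCM_symm_pi`, `locallyCompactSpace_archLocal`, `secondCountableTopology_archLocal`
import HarnessLib

/-!
# Every Haar measure on `U(diag α)(L⁺ ⊗ ℝ)` IS a product-Haar reading `e⁻¹_*(⊗_v ν_v)` ((E4c) of the (ST-∞) dress; Borel–Jacquet §4.1, Rogawski 1990 §1.7)

Topic `NumberTheory/Automorphic`; namespace `Literature.NumberTheory.Automorphic.UnitaryGroup`.  THEOREMS ONLY (no `def`, no instance, no notation, no axiom, no `sorry`).  `N`-general.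
Cell `pub/hodgecm-mathlib`, ENGINE T1 (crux H413 = `stmt-HodgeConjecture-24833`); floor-2 road «(J-nc) in-house», brick (E4c) of the (ST-∞) dress (census (R1-i-END) e599836f); author
F0P3a-p07 (g8), 2026-09-01.

WHY.  ★ p842366 (the R1 engine) and ★ (R1-i-d) `sum_inv_mul_integral_pi_map_conj_eq_of_isArchInnerTransfer` read the Haar measure of the diagonal carrier `G′_∞ = U(diag α)(L⁺ ⊗ ℝ)` in the
PRODUCT CONVENTION `ν_∞ = e⁻¹_*(⊗_v ν_v)` along ★ `archPiEquivCM : G′_∞ ≃ₜ* Π_v G_v` (hypotheses `hνinf` ∕ `hν′ : ν′.map Ψ = (Measure.pi νw).map e.symm`), whereas the closer hands over ONE Haar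
measure on the carrier (transported along the (T-d) congruence).  «All measures on groups are assumed to be Haar measures» (§1.7 p. 6), «`G_∞ = Π_v G(F_v)`» (Borel–Jacquet §4.1): the
honest content is that EVERY Haar measure on `G′_∞` is such a product, because `e⁻¹_*(⊗_v ν⁰_v)` is Haar (★ (h0)) and Haar measures are unique up to a positive scalar (Mathlib
`Measure.isMulLeftInvariant_eq_smul`, second countable locally compact group), the scalar being absorbed into ONE factor (`Function.update`; a number field has an infinite place, which is
complex for a CM field).

WHAT IS PROVED.
* `pi_update_smul` (generic): `⊗_v (ν_v)[v₀ ↦ c • ν_{v₀}] = c • ⊗_v ν_v` (Mathlib `Measure.pi_eq`).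
* **`exists_isHaarMeasure_eq_map_archPiEquivCM_symm_pi`**: for every Haar measure `μ` on `U(diag α)(L⁺ ⊗ ℝ)` there are per-place Haar measures `ν_v` on `G_v = archLocal` with
  `μ = (Measure.pi ν).map (archPiEquivCM N L (diagonal α)).symm` — the `νw ∕ hνw ∕ hν′` inputs of ★ (R1-i-d) and the `νw hνw νinf hνinf` inputs of ★ p842366 ∕ p842470 for ANY given Haar `μ`.
HONEST LABEL: HC_CM is proved only modulo the 7 printed citations until rung 0 closes; this file is measure bookkeeping and pays nothing by itself.

## References
* [BorelJacquet1979] A. Borel, H. Jacquet, *Automorphic forms and automorphic representations*, PSPM 33.1 (1979), §4.1 (`G_∞ = Π_v G(F_v)`, product measures).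
* [Rogawski1990] J. D. Rogawski, *Automorphic Representations of Unitary Groups in Three Variables*, Ann. of Math. Stud. 123 (1990), §1.7 p. 6.
* [Folland1995] G. B. Folland, *A Course in Abstract Harmonic Analysis* (1995), §2.2 Thm. 2.20 (uniqueness of Haar measure).
-/

set_option autoImplicit false

noncomputable section

open MeasureTheory Measure NumberField NumberField.InfinitePlace NumberField.mixedEmbedding Function Set
open scoped Matrix MatrixGroups ENNReal NNReal

/-! ## §1 One rescaled factor rescales the product measure -/

namespace Literature.MeasureTheory.Group

/-- **`⊗_i (μ_i)[i₀ ↦ c • μ_{i₀}] = c • ⊗_i μ_i`** for σ-finite factors on a finite index set (Mathlib `Measure.pi_eq` on boxes; `Finset.prod_erase_mul`). [cite: Folland1995, §2.2] -/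
theorem pi_update_smul {ι : Type*} [Fintype ι] [DecidableEq ι] {X : ι → Type*} [∀ i, MeasurableSpace (X i)]
    (μ : ∀ i, Measure (X i)) [∀ i, SigmaFinite (μ i)] (i₀ : ι) (c : ℝ≥0) :
    Measure.pi (Function.update μ i₀ (c • μ i₀)) = c • Measure.pi μ := by
  haveI : ∀ i, SigmaFinite (Function.update μ i₀ (c • μ i₀) i) := fun i => by
    by_cases hi : i = i₀
    · subst hi
      rw [Function.update_self]
      infer_instance
    · rw [Function.update_of_ne hi]
      infer_instance
  apply Measure.pi_eq
  intro s _
  rw [Measure.coe_nnreal_smul_apply, Measure.pi_pi]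
  have e1 : ∏ i, μ i (s i) = (∏ i ∈ Finset.univ.erase i₀, μ i (s i)) * μ i₀ (s i₀) :=
    (Finset.prod_erase_mul _ (fun i => μ i (s i)) (Finset.mem_univ i₀)).symm
  have e2 : ∏ i, (Function.update μ i₀ (c • μ i₀) i) (s i) = (∏ i ∈ Finset.univ.erase i₀, μ i (s i)) * (c * μ i₀ (s i₀)) := by
    rw [← Finset.prod_erase_mul _ (fun i => (Function.update μ i₀ (c • μ i₀) i) (s i)) (Finset.mem_univ i₀), Function.update_self,
      Measure.coe_nnreal_smul_apply]
    congr 1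
    exact Finset.prod_congr rfl fun i hi => by rw [Function.update_of_ne (Finset.ne_of_mem_erase hi)]
  rw [e1, e2]
  ring

end Literature.MeasureTheory.Group

/-! ## §2 Every Haar measure on the diagonal carrier is a product-Haar reading -/

namespace Literature.NumberTheory.Automorphic.UnitaryGroup

open Literature.MeasureTheory.Group

variable (L : Type) [Field L] [NumberField L] [IsCMField L] (N : ℕ) (α : Fin N → L)
  [MeasurableSpace (arch (↥(maximalRealSubfield L)) L (IsCMField.complexConj L) N (Matrix.diagonal α))]
  [BorelSpace (arch (↥(maximalRealSubfield L)) L (IsCMField.complexConj L) N (Matrix.diagonal α))]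
  [∀ v : {w : InfinitePlace L // IsComplex w}, MeasurableSpace (archLocal L N (Matrix.diagonal α) v)]
  [∀ v : {w : InfinitePlace L // IsComplex w}, BorelSpace (archLocal L N (Matrix.diagonal α) v)]

open scoped Classical in
/-- **EVERY HAAR MEASURE ON `U(diag α)(L⁺ ⊗ ℝ)` IS `e⁻¹_*(⊗_v ν_v)` FOR PER-PLACE HAAR MEASURES `ν_v`** (★ (h0) `isHaarMeasure_map_archPiEquivCM_symm_pi`: the product reading of any per-place
Haar family is Haar; Haar uniqueness on the second countable locally compact `G′_∞` gives `μ = c • e⁻¹_*(⊗_v ν⁰_v)`, `0 < c < ∞`; the scalar goes into the factor at one complex place,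
`pi_update_smul`) — the `νw ∕ νinf ∕ hν′` inputs of ★ p842366, ★ p842470 and ★ (R1-i-d) for ANY given Haar measure on the carrier. [cite: BorelJacquet1979, §4.1] [cite: Rogawski1990, §1.7 p. 6]
[cite: Folland1995, §2.2 Thm. 2.20] -/
theorem exists_isHaarMeasure_eq_map_archPiEquivCM_symm_pi
    (μ : Measure (arch (↥(maximalRealSubfield L)) L (IsCMField.complexConj L) N (Matrix.diagonal α))) [μ.IsHaarMeasure] :
    ∃ νw : ∀ v : {w : InfinitePlace L // IsComplex w}, Measure (archLocal L N (Matrix.diagonal α) v),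
      (∀ v, (νw v).IsHaarMeasure) ∧ μ = (Measure.pi νw).map (archPiEquivCM N L (Matrix.diagonal α)).symm := by
  haveI : ∀ v : {w : InfinitePlace L // IsComplex w}, LocallyCompactSpace (archLocal L N (Matrix.diagonal α) v) :=
    fun v => locallyCompactSpace_archLocal L N (Matrix.diagonal α) v
  haveI : ∀ v : {w : InfinitePlace L // IsComplex w}, SecondCountableTopology (archLocal L N (Matrix.diagonal α) v) :=
    fun v => secondCountableTopology_archLocal L N (Matrix.diagonal α) v
  -- a reference product reading
  set ν₀ : ∀ v : {w : InfinitePlace L // IsComplex w}, Measure (archLocal L N (Matrix.diagonal α) v) := fun v => Measure.haar with hν₀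
  haveI h0 : ∀ v, (ν₀ v).IsHaarMeasure := fun v => by rw [hν₀]; infer_instance
  haveI : ((Measure.pi ν₀).map (archPiEquivCM N L (Matrix.diagonal α)).symm).IsHaarMeasure := isHaarMeasure_map_archPiEquivCM_symm_pi L N α ν₀
  -- Haar uniqueness
  have hc : μ = μ.haarScalarFactor ((Measure.pi ν₀).map (archPiEquivCM N L (Matrix.diagonal α)).symm) • ((Measure.pi ν₀).map (archPiEquivCM N L (Matrix.diagonal α)).symm) :=
    Measure.isMulLeftInvariant_eq_smul μ _
  have hcpos : 0 < μ.haarScalarFactor ((Measure.pi ν₀).map (archPiEquivCM N L (Matrix.diagonal α)).symm) := Measure.haarScalarFactor_pos_of_isHaarMeasure μ _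
  -- one complex place to carry the scalar
  have v₀ : {w : InfinitePlace L // IsComplex w} := ⟨Classical.arbitrary (InfinitePlace L), IsTotallyComplex.isComplex _⟩
  refine ⟨Function.update ν₀ v₀ (μ.haarScalarFactor ((Measure.pi ν₀).map (archPiEquivCM N L (Matrix.diagonal α)).symm) • ν₀ v₀), fun v => ?_, ?_⟩
  · by_cases hv : v = v₀
    · subst hv
      rw [Function.update_self]
      have h1 : ((μ.haarScalarFactor ((Measure.pi ν₀).map (archPiEquivCM N L (Matrix.diagonal α)).symm) : ℝ≥0∞) • ν₀ v).IsHaarMeasure :=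
        IsHaarMeasure.smul _ (by exact_mod_cast hcpos.ne') ENNReal.coe_ne_top
      rwa [← ENNReal.smul_def] at h1
    · rw [Function.update_of_ne hv]
      exact h0 v
  · rw [pi_update_smul ν₀ v₀, Measure.map_smul]
    exact hc

end Literature.NumberTheory.Automorphic.UnitaryGroup

end
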